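import Mathlib
import HarnessLib
import Summits.Ventures.LatticeQCDFlow.Exactness.SU2LeapfrogHMC

/-!
# Single-step leapfrog HMC on `SU(2)` lattice gauge fields is uniformly ergodic

HONEST FRAMING: exact (Metropolis-corrected) sampling algorithms for lattice gauge theory;
figures of merit are autocorrelation/cost numbers at stated couplings and volumes; no
continuum-physics claim.

Venture `LatticeQCDFlow` (cell pub-lqcd), topic `Exactness`, FANOUT row 9 (eng-latcore, the
engine `latflow.core.hmc.HMC(f, β, 'leapfrog')` on `SU(2)`, `trajectory(τ, nstep = 1)`).  NEW
WORK of the cell over Mathlib and the tree (part 1 `SU2LeapfrogHMC.lean`: the kernel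
`su2LeapfrogHMC` and its exactness; `LeapfrogHMCDoeblin.lean`: the abstract Doeblin minorant of
refresh–propose–accept–forget and of the one-step P-first leapfrog, `smul_pi_le_pi`;
`SU2ExpChartMinorisation.lean`: one kicked exponential drift of a ball-uniform momentum dominates
`(2π²/ε³) •` Haar on `SU(2)`; `RefreshScan.lean` / `DoeblinUniqueness.lean`); nothing here is cited
as a fact.  Printed counterparts, named only: Duane–Kennedy–Pendleton–Roweth 1987, Mackenzie 1989
(fixed trajectory lengths), Meyn–Tweedie ch. 16 (Doeblin).

WHAT IS PROVED (links `ι → SU(2)`, `ι` finite; step `ε > 0`; kinetic coefficient `κ > 0`; ANY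
measurable momentum increment `g` bounded by `b`; ANY measurable action `S` bounded by `s` — the
Wilson action at any `β` is continuous on the compact configuration space, hence bounded):

* §2 `smul_restrict_momBox_le_su2MomentumLaw` — the Gaussian refresh dominates
  `Z⁻¹e^{−κ|ι|R²} ·` Lebesgue on the momentum box `|p_l| < R`; `su2Leapfrog_energy_window` — on the
  box `H(Ψ(U,p)) ≤ H(U,p) + 2s + κ|ι|(R + 2b)²`; `smul_pi_haar_le_map_kickDrift` — one kicked drift of
  box-uniform momenta (`R = π/ε + b`) dominates `(2π²/ε³)^{|ι|} ·` product Haar, uniformly in `U`;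
  **`su2LeapfrogHMC_minorised`** — DOEBLIN: `∃ δ > 0, ∀ U, K(U, ·) ≥ δ · Haar^{⊗ι}`.
* §3 **`su2LeapfrogHMC_uniformlyErgodic`** — `∃ δ ∈ (0,1]`: `|μ₀Kᵗ(A) − π_S(A)| ≤ (1 − δ)ᵗ` for
  every initial law `μ₀`, every `t`, every set `A`, `π_S = Z_S⁻¹ e^{−S} · Haar^{⊗ι}` (`su2GibbsLaw`,
  a probability law: `isProbabilityMeasure_su2GibbsLaw`; invariant: `su2LeapfrogHMC_invariant_gibbsLaw`);
  **`su2LeapfrogHMC_invariant_unique`** — `π_S` is the ONLY invariant probability law.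

This closes, for `SU(2)` and single-step trajectories, the row "HMC ergodicity: not typed" of the
engine's exactness table.  NOT CLAIMED: trajectories with `nstep ≥ 2`, `'omf2'` / `'omf4'`,
`tau_jitter` (two or more drifts compose and no hypothesis-free minorant is offered — fixed-length
trajectories can be non-ergodic, Mackenzie 1989; the engine's `tau_jitter` exists for that reason);
`SU(N ≥ 3)` (no exponential-chart Haar density in the tree); any useful RATE (`δ` is astronomically
small: `e^{−(2s+κ|ι|(π/ε+3b)²)} · Z⁻¹e^{−κ|ι|(π/ε+b)²}·vol(box) · (2π²/ε³)^{|ι|}`-sized); floating point.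
-/

noncomputable section

namespace Summit.Ventures.LatticeQCDFlow.Exactness

open MeasureTheory ProbabilityTheory ProbabilityTheory.Kernel Set Metric
open Literature.MathematicalPhysics.QuantumFieldTheory (haarProbability)
open Literature.MathematicalPhysics.QuantumFieldTheory.Balaban1983to89.B10Eq18SigmaSU2Haar
  (expPauli measurable_expPauli continuous_expPauli)
open scoped ENNReal

variable {ι : Type*}

/-! ## §2 Doeblin: the kernel dominates a multiple of product Haar measure from every configuration -/

section Doeblin

variable [Fintype ι] {ε κ : ℝ} {g : (ι → Matrix.specialUnitaryGroup (Fin 2) ℂ) → ι → EuclideanSpace ℝ (Fin 3)}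

/-- The momentum box `|p_l| < R` for every link. -/
def momBox (R : ℝ) : Set (ι → EuclideanSpace ℝ (Fin 3)) := Set.pi univ fun _ => ball 0 R

omit [Fintype ι] in
/-- The momentum box is measurable (a countable product is not needed: `Set.pi` over a finite
type of balls). -/
theorem measurableSet_momBox [Countable ι] (R : ℝ) : MeasurableSet (momBox (ι := ι) R) :=
  MeasurableSet.univ_pi fun _ => measurableSet_ball

omit [Fintype ι] in
/-- Inside the box every component is shorter than `R`. -/
theorem norm_le_of_mem_momBox {R : ℝ} {p : ι → EuclideanSpace ℝ (Fin 3)} (hp : p ∈ momBox R) (l : ι) :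
    ‖p l‖ ≤ R :=
  (mem_ball_zero_iff.1 (hp l (mem_univ l))).le

/-- **The Gaussian refresh dominates a multiple of Lebesgue measure on the box**:
`Z⁻¹ e^{−κ|ι|R²} · dp|_{box R} ≤ Z⁻¹ e^{−T_κ} dp`. -/
theorem smul_restrict_momBox_le_su2MomentumLaw (hκ : 0 < κ) (R : ℝ) :
    ((su2MomentumWeight (ι := ι) κ univ)⁻¹ *
        ENNReal.ofReal (Real.exp (-(κ * (Fintype.card ι * R ^ 2))))) • volume.restrict (momBox (ι := ι) R) ≤
      su2MomentumLaw κ := by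
  rw [su2MomentumLaw, mul_smul]
  have hinner : ENNReal.ofReal (Real.exp (-(κ * (Fintype.card ι * R ^ 2)))) • volume.restrict (momBox (ι := ι) R) ≤
      su2MomentumWeight κ := by
    rw [← withDensity_const, su2MomentumWeight]
    calc (volume.restrict (momBox (ι := ι) R)).withDensity
          (fun _ => ENNReal.ofReal (Real.exp (-(κ * (Fintype.card ι * R ^ 2)))))
        ≤ (volume.restrict (momBox (ι := ι) R)).withDensity
            fun p => ENNReal.ofReal (Real.exp (-su2Kinetic κ p)) := by
          refine withDensity_mono ((ae_restrict_iff' (measurableSet_momBox R)).2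
            (Filter.Eventually.of_forall fun p hp => ?_))
          exact ENNReal.ofReal_le_ofReal (Real.exp_le_exp.2 (neg_le_neg
            (su2Kinetic_le_of_norm_le hκ.le (norm_le_of_mem_momBox hp))))
      _ = (volume.withDensity fun p => ENNReal.ofReal (Real.exp (-su2Kinetic κ p))).restrict (momBox R) :=
          (restrict_withDensity (measurableSet_momBox R) _).symm
      _ ≤ volume.withDensity fun p => ENNReal.ofReal (Real.exp (-su2Kinetic κ p)) := Measure.restrict_le_self
  refine Measure.le_iff'.2 fun A => ?_
  have hA := Measure.le_iff'.1 hinner A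
  simp only [Measure.smul_apply, smul_eq_mul] at hA ⊢
  gcongr

/-- **The energy window of one leapfrog step**: for momenta in the box `|p_l| ≤ R`, a force bounded
by `b` and an action bounded by `s`, `H(Ψ(U, p)) ≤ H(U, p) + 2s + κ|ι|(R + 2b)²`. -/
theorem su2Leapfrog_energy_window (hκ : 0 ≤ κ) {b : ℝ} (hb : ∀ u l, ‖g u l‖ ≤ b)
    {S : (ι → Matrix.specialUnitaryGroup (Fin 2) ℂ) → ℝ} {s : ℝ} (hs : ∀ u, |S u| ≤ s) {R : ℝ}
    (u : ι → Matrix.specialUnitaryGroup (Fin 2) ℂ) {p : ι → EuclideanSpace ℝ (Fin 3)} (hp : ∀ l, ‖p l‖ ≤ R) :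
    (fun z : (ι → Matrix.specialUnitaryGroup (Fin 2) ℂ) × (ι → EuclideanSpace ℝ (Fin 3)) =>
        S z.1 + su2Kinetic κ z.2) (su2LeapfrogProposal ε g (u, p)) ≤
      (fun z : (ι → Matrix.specialUnitaryGroup (Fin 2) ℂ) × (ι → EuclideanSpace ℝ (Fin 3)) =>
        S z.1 + su2Kinetic κ z.2) (u, p) + (2 * s + κ * (Fintype.card ι * (R + 2 * b) ^ 2)) := by
  rw [su2LeapfrogProposal, flip_kdk_apply]
  simp only [su2Kinetic_neg]
  have h1 : S (mulDrift (su2ExpDrift ε) (p + g u) u) ≤ s := (abs_le.1 (hs _)).2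
  have h2 : -s ≤ S u := (abs_le.1 (hs u)).1
  have h3 : 0 ≤ su2Kinetic κ p := su2Kinetic_nonneg hκ p
  have h4 : su2Kinetic κ (p + g u + g (mulDrift (su2ExpDrift ε) (p + g u) u)) ≤
      κ * (Fintype.card ι * (R + 2 * b) ^ 2) := by
    refine su2Kinetic_le_of_norm_le hκ fun l => ?_
    simp only [Pi.add_apply]
    calc ‖p l + g u l + g (mulDrift (su2ExpDrift ε) (p + g u) u) l‖
        ≤ ‖p l‖ + ‖g u l‖ + ‖g (mulDrift (su2ExpDrift ε) (p + g u) u) l‖ := norm_add₃_le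
      _ ≤ R + b + b := add_le_add (add_le_add (hp l) (hb u l)) (hb _ l)
      _ = R + 2 * b := by ring
  linarith

/-- **One kicked drift of box-uniform momenta dominates `(2π²/ε³)^{|ι|} ·` product Haar measure**,
uniformly in the configuration (link by link: `SU2ExpChartMinorisation.smul_haarProbability_le_map_kickDrift`;
over the lattice: `LeapfrogHMCDoeblin.smul_pi_le_pi`). -/
theorem smul_pi_haar_le_map_kickDrift (hε : 0 < ε) {b : ℝ} (hb : ∀ u l, ‖g u l‖ ≤ b)
    (u : ι → Matrix.specialUnitaryGroup (Fin 2) ℂ) :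
    (ENNReal.ofReal (2 * Real.pi ^ 2 / ε ^ 3) ^ Fintype.card ι) •
        Measure.pi (fun _ : ι => haarProbability (Matrix.specialUnitaryGroup (Fin 2) ℂ)) ≤
      (volume.restrict (momBox (ι := ι) (Real.pi / ε + b))).map
        (fun p => mulDrift (su2ExpDrift ε) (p + g u) u) := by
  classical
  haveI hfin : IsFiniteMeasure ((volume : Measure (EuclideanSpace ℝ (Fin 3))).restrict
      (ball (0 : EuclideanSpace ℝ (Fin 3)) (Real.pi / ε + b))) :=
    ⟨by rw [Measure.restrict_apply_univ]; exact measure_ball_lt_top⟩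
  have hF : (fun p : ι → EuclideanSpace ℝ (Fin 3) => mulDrift (su2ExpDrift ε) (p + g u) u) =
      fun p l => (fun (l : ι) (A : EuclideanSpace ℝ (Fin 3)) => expPauli (ε • (g u l + A)) * u l) l (p l) := by
    funext p l
    simp only [mulDrift, Equiv.coe_mulLeft, Pi.mul_apply, su2ExpDrift_apply, Pi.add_apply, add_comm (p l) (g u l)]
  rw [hF, momBox, volume_pi, Measure.restrict_pi_pi,
    Measure.pi_map_pi (fun l => (measurable_kickDrift ε (g u l) (u l)).aemeasurable),
    ← Finset.card_univ, ← Finset.prod_const]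
  exact smul_pi_le_pi fun l =>
    smul_haarProbability_le_map_kickDrift hε (by linarith [hb u l]) (u l)

/-- **DOEBLIN FOR SINGLE-STEP LEAPFROG HMC ON `SU(2)^ι`.**  For every step size `ε > 0`, kinetic
coefficient `κ > 0`, measurable force increment bounded by `b ≥ 0` and measurable action bounded by
`s`, there is `δ > 0` with `K(U, ·) ≥ δ · Haar^{⊗ι}` from EVERY configuration `U`. -/
theorem su2LeapfrogHMC_minorised (hε : 0 < ε) (hκ : 0 < κ) (hg : Measurable g) {b : ℝ} (hb0 : 0 ≤ b)
    (hb : ∀ u l, ‖g u l‖ ≤ b) {S : (ι → Matrix.specialUnitaryGroup (Fin 2) ℂ) → ℝ} (hS : Measurable S)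
    {s : ℝ} (hs : ∀ u, |S u| ≤ s) :
    ∃ δ : ℝ≥0∞, 0 < δ ∧ ∀ u, δ • Measure.pi (fun _ : ι => haarProbability (Matrix.specialUnitaryGroup (Fin 2) ℂ)) ≤
      su2LeapfrogHMC ε κ hg S u := by
  classical
  haveI : Fact (0 < κ) := ⟨hκ⟩
  set R : ℝ := Real.pi / ε + b with hR
  set c : ℝ≥0∞ := (su2MomentumWeight (ι := ι) κ univ)⁻¹ *
    ENNReal.ofReal (Real.exp (-(κ * (Fintype.card ι * R ^ 2)))) with hc
  set B : ℝ := 2 * s + κ * (Fintype.card ι * (R + 2 * b) ^ 2) with hB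
  set θ : ℝ≥0∞ := ENNReal.ofReal (2 * Real.pi ^ 2 / ε ^ 3) ^ Fintype.card ι with hθ
  have hH : Measurable fun z : (ι → Matrix.specialUnitaryGroup (Fin 2) ℂ) × (ι → EuclideanSpace ℝ (Fin 3)) =>
      S z.1 + su2Kinetic κ z.2 :=
    (hS.comp measurable_fst).add ((measurable_su2Kinetic κ).comp measurable_snd)
  have hs0 : 0 ≤ s := (abs_nonneg _).trans (hs fun _ => 1)
  have hB0 : 0 ≤ B := by positivity
  refine ⟨ENNReal.ofReal (Real.exp (-B)) * (c * θ), ?_, fun u => ?_⟩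
  · refine ENNReal.mul_pos (ENNReal.ofReal_pos.2 (Real.exp_pos _)).ne' (mul_ne_zero (mul_ne_zero ?_ ?_) ?_)
    · exact ENNReal.inv_ne_zero.2 (su2MomentumWeight_univ_ne_top hκ)
    · exact (ENNReal.ofReal_pos.2 (Real.exp_pos _)).ne'
    · exact pow_ne_zero _ (ENNReal.ofReal_pos.2 (by positivity)).ne'
  · refine kdkHMC_minorised (measurable_su2LeapfrogProposal ε hg) hH (su2MomentumLaw κ)
      (ρ := c • volume.restrict (momBox (ι := ι) R)) (smul_restrict_momBox_le_su2MomentumLaw hκ R)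
      (fun v => Measure.ae_smul_measure ((ae_restrict_iff' (measurableSet_momBox R)).2
        (Filter.Eventually.of_forall fun p hp => le_involAcceptE_of_le hB0
          (su2Leapfrog_energy_window hκ.le hb hs v (norm_le_of_mem_momBox hp)))) _)
      (fun v => ?_) u
    rw [Measure.map_smul, mul_smul]
    refine Measure.le_iff'.2 fun A => ?_
    have hA := Measure.le_iff'.1 (smul_pi_haar_le_map_kickDrift hε hb v) A
    simp only [Measure.smul_apply, smul_eq_mul] at hA ⊢
    gcongr

end Doeblin

/-! ## §3 Uniform ergodicity: convergence to the Gibbs law from every start, uniqueness -/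

section Ergodic

variable [Fintype ι] {ε κ : ℝ} {g : (ι → Matrix.specialUnitaryGroup (Fin 2) ℂ) → ι → EuclideanSpace ℝ (Fin 3)}
  {S : (ι → Matrix.specialUnitaryGroup (Fin 2) ℂ) → ℝ} {s : ℝ}

/-- The Gibbs weight of a bounded measurable action has finite non-zero mass:
`e^{−s} ≤ Z_S ≤ e^{s}`. -/
theorem su2GibbsWeight_univ_ne (hs : ∀ u, |S u| ≤ s) :
    ((Measure.pi fun _ : ι => haarProbability (Matrix.specialUnitaryGroup (Fin 2) ℂ)).withDensity
        fun u => ENNReal.ofReal (Real.exp (-S u))) univ ≠ 0 ∧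
    ((Measure.pi fun _ : ι => haarProbability (Matrix.specialUnitaryGroup (Fin 2) ℂ)).withDensity
        fun u => ENNReal.ofReal (Real.exp (-S u))) univ ≠ ⊤ := by
  rw [withDensity_apply _ MeasurableSet.univ, Measure.restrict_univ]
  constructor
  · intro h0
    have hle : ∫⁻ _u : ι → Matrix.specialUnitaryGroup (Fin 2) ℂ, ENNReal.ofReal (Real.exp (-s))
        ∂(Measure.pi fun _ : ι => haarProbability (Matrix.specialUnitaryGroup (Fin 2) ℂ)) ≤ 0 := by
      rw [← h0]
      exact lintegral_mono fun u => ENNReal.ofReal_le_ofReal (Real.exp_le_exp.2 (by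
        have := (abs_le.1 (hs u)).2; linarith))
    rw [MeasureTheory.lintegral_const, measure_univ, mul_one, nonpos_iff_eq_zero, ENNReal.ofReal_eq_zero] at hle
    exact absurd hle (not_le.2 (Real.exp_pos _))
  · refine ne_top_of_le_ne_top (ENNReal.ofReal_ne_top (r := Real.exp s)) ?_
    calc ∫⁻ u, ENNReal.ofReal (Real.exp (-S u))
          ∂(Measure.pi fun _ : ι => haarProbability (Matrix.specialUnitaryGroup (Fin 2) ℂ))
        ≤ ∫⁻ _u, ENNReal.ofReal (Real.exp s)
            ∂(Measure.pi fun _ : ι => haarProbability (Matrix.specialUnitaryGroup (Fin 2) ℂ)) :=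
          lintegral_mono fun u => ENNReal.ofReal_le_ofReal (Real.exp_le_exp.2 (by
            have := (abs_le.1 (hs u)).1; linarith))
      _ = ENNReal.ofReal (Real.exp s) := by rw [MeasureTheory.lintegral_const, measure_univ, mul_one]

/-- The Gibbs law of a bounded measurable action is a probability law. -/
theorem isProbabilityMeasure_su2GibbsLaw (hs : ∀ u, |S u| ≤ s) :
    IsProbabilityMeasure (su2GibbsLaw (ι := ι) S) :=
  ⟨by rw [su2GibbsLaw, Measure.smul_apply, smul_eq_mul,
    ENNReal.inv_mul_cancel (su2GibbsWeight_univ_ne hs).1 (su2GibbsWeight_univ_ne hs).2]⟩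

/-- The kernel leaves the (normalised) Gibbs law invariant. -/
theorem su2LeapfrogHMC_invariant_gibbsLaw (hκ : 0 < κ) (hg : Measurable g) (hS : Measurable S) :
    Invariant (su2LeapfrogHMC ε κ hg S) (su2GibbsLaw S) :=
  invariant_smul (su2LeapfrogHMC_invariant hκ hg hS) _

/-- **SINGLE-STEP LEAPFROG HMC ON `SU(2)^ι` IS UNIFORMLY ERGODIC.**  For every step size `ε > 0`,
`κ > 0`, measurable force increment bounded by `b ≥ 0`, measurable action bounded by `s`: there is
`δ ∈ (0, 1]` such that for EVERY initial law `μ₀`, every `t` and every set `A`,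
`|μ₀Kᵗ(A) − π_S(A)| ≤ (1 − δ)ᵗ`, `π_S = Z_S⁻¹ e^{−S} · Haar^{⊗ι}`. -/
theorem su2LeapfrogHMC_uniformlyErgodic (hε : 0 < ε) (hκ : 0 < κ) (hg : Measurable g) {b : ℝ}
    (hb0 : 0 ≤ b) (hb : ∀ u l, ‖g u l‖ ≤ b) (hS : Measurable S) (hs : ∀ u, |S u| ≤ s) :
    ∃ δ : ℝ, 0 < δ ∧ δ ≤ 1 ∧ ∀ (μ₀ : Measure (ι → Matrix.specialUnitaryGroup (Fin 2) ℂ))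
      [IsProbabilityMeasure μ₀] (t : ℕ) (A : Set (ι → Matrix.specialUnitaryGroup (Fin 2) ℂ)),
      |((fun m : Measure (ι → Matrix.specialUnitaryGroup (Fin 2) ℂ) => m.bind (su2LeapfrogHMC ε κ hg S))^[t] μ₀).real A
          - (su2GibbsLaw S).real A| ≤ (1 - δ) ^ t := by
  haveI : Fact (0 < κ) := ⟨hκ⟩
  haveI := isProbabilityMeasure_su2GibbsLaw (ι := ι) hs
  obtain ⟨δ, hδ0, hmin⟩ := su2LeapfrogHMC_minorised hε hκ hg hb0 hb hS hs
  have hH : Measurable fun z : (ι → Matrix.specialUnitaryGroup (Fin 2) ℂ) × (ι → EuclideanSpace ℝ (Fin 3)) =>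
      S z.1 + su2Kinetic κ z.2 :=
    (hS.comp measurable_fst).add ((measurable_su2Kinetic κ).comp measurable_snd)
  haveI : Fact (Measurable fun z : (ι → Matrix.specialUnitaryGroup (Fin 2) ℂ) × (ι → EuclideanSpace ℝ (Fin 3)) =>
      S z.1 + su2Kinetic κ z.2) := ⟨hH⟩
  haveI : IsMarkovKernel (su2LeapfrogHMC ε κ hg S) := by unfold su2LeapfrogHMC; infer_instance
  have hδ1 : δ ≤ 1 := by
    have h := Measure.le_iff'.1 (hmin fun _ => 1) univ
    rwa [Measure.smul_apply, smul_eq_mul, measure_univ, measure_univ, mul_one] at h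
  have hδtop : δ ≠ ⊤ := ne_top_of_le_ne_top ENNReal.one_ne_top hδ1
  refine ⟨δ.toReal, ENNReal.toReal_pos hδ0.ne' hδtop,
    ENNReal.toReal_le_of_le_ofReal zero_le_one (by rwa [ENNReal.ofReal_one]), fun μ₀ _ t A => ?_⟩
  exact refreshUpdate_involMH_uniformlyErgodic (measurable_su2LeapfrogProposal ε hg) hH (su2MomentumLaw κ)
    hmin (su2LeapfrogHMC_invariant_gibbsLaw hκ hg hS) μ₀ t A

/-- **The Gibbs law is the unique invariant probability law** of single-step leapfrog HMC on
`SU(2)^ι` (bounded measurable force and action, `ε, κ > 0`). -/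
theorem su2LeapfrogHMC_invariant_unique (hε : 0 < ε) (hκ : 0 < κ) (hg : Measurable g) {b : ℝ}
    (hb0 : 0 ≤ b) (hb : ∀ u l, ‖g u l‖ ≤ b) (hS : Measurable S) (hs : ∀ u, |S u| ≤ s)
    {π' : Measure (ι → Matrix.specialUnitaryGroup (Fin 2) ℂ)} [IsProbabilityMeasure π']
    (hπ' : Invariant (su2LeapfrogHMC ε κ hg S) π') : π' = su2GibbsLaw S := by
  haveI : Fact (0 < κ) := ⟨hκ⟩
  haveI := isProbabilityMeasure_su2GibbsLaw (ι := ι) hs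
  obtain ⟨δ, hδ0, hmin⟩ := su2LeapfrogHMC_minorised hε hκ hg hb0 hb hS hs
  have hH : Measurable fun z : (ι → Matrix.specialUnitaryGroup (Fin 2) ℂ) × (ι → EuclideanSpace ℝ (Fin 3)) =>
      S z.1 + su2Kinetic κ z.2 :=
    (hS.comp measurable_fst).add ((measurable_su2Kinetic κ).comp measurable_snd)
  exact refreshUpdate_involMH_invariant_unique (measurable_su2LeapfrogProposal ε hg) hH (su2MomentumLaw κ)
    hmin hδ0 (su2LeapfrogHMC_invariant_gibbsLaw hκ hg hS) hπ'

end Ergodic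

end Summit.Ventures.LatticeQCDFlow.Exactness
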